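import Mathlib
import Literature.MathematicalPhysics.QuantumFieldTheory.Balaban1983to89.B9
import Literature.MathematicalPhysics.QuantumFieldTheory.Balaban1983to89.B6Cor28
import Literature.MathematicalPhysics.QuantumFieldTheory.Balaban1983to89.B9Ineq349

/-!
# `Balaban1983to89.B8Ineq192` — the inequality (1.92) of B8 for H′ = G′²Q′\*(Q′G′²Q′\*)^{−1}, KERNEL-CHECKED
from B9 Theorems 3.1–3.2 and Lemma 2.1 of [4] = B6 (cell GAPS G-B8-03: "can be obtained from the results of
this paper" — the summation paragraph neither B8 nor B9 prints)

CITATION HEADER (lean-in-tree rule 2026-08-18).  Source of the STATEMENT: T. Bałaban, *Spaces of regular gauge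
field configurations on a lattice and gauge fixing conditions*, Commun. Math. Phys. **99**, 75–102 (1985)
[Balaban1985RegularSpaces] (cell paper B8; held `paper:balaban1985-cmp99-regular-spaces-gauge-fixing`, journal page
= PDF page + 74; quotations read from the page renders p. 91 [PDF 17], p. 92 [PDF 18]).  P. 91, after (1.91)
*"H′ = G′²Q′\*(Q′G′²Q′\*)^{−1}, G′ = (Δ + Q′\*aQ′)^{−1}. (1.91)"*, verbatim: *"They were investigated in [4], and
the following inequality can be obtained from the results of this paper: |(H′X)(x)|, |(∇H′X)(x)| ≦ B′₀[1,
(L^jη)^{−1}]|X| for x ∈ Ω_j, (1.92)"*; p. 92, verbatim: *"where (H′X)(x) = Σ_{y′∈𝔅_k}(L^{j′}η)^d H′(x, y′)X(y′),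
and B′₀ is an absolute constant (depending on d and L only)."* (the weight (L^{j′}η)^d carries the PRINTED prime:
j′ = j(y′), the scale of y′ ∈ Λ_{j′} — the coarse measure on 𝔅_k, as in [4] (3.48) and [Balaban1984PropagatorsII]
(2.150); transcription corrected after referee GAPS G-ref1-10 (c), render p018 re-read: the prime is printed).  Here [4] =
T. Bałaban, *Propagators for lattice gauge theories in a background field*, Commun. Math. Phys. **99**, 389–434
(1985) [Balaban1985BackgroundPropagators] (cell paper B9; `paper:balaban1985-cmp99-background-propagators`,
journal page = PDF page + 388), whose "results" used are, verbatim: Theorem 3.1 (3.42) p. 397 [PDF 9]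
*"|(G′(U)λ)(x)|, |(∇_U G′(U)λ)(x)|, |(G′(U)∇\*_U λ)(x)|, |(Δ_U G′(U)λ)(x)| ≦ B₀[(L^jη)², L^jη, L^jη, 1]
e^{−δ₀d(y,y′)}|λ| for x ∈ Δ(y), y ∈ Λ_j, supp λ ⊂ Δ(y′); (3.42)"* (typed in `…B9` as the first clause of
`B9.Ineq342_346_347`) and Theorem 3.2 (3.48) p. 398 [PDF 10] *"Under the assumptions of Theorem 3.1, and with the
same constants, the following inequality holds: |(Q′(U)G′²(U)Q′\*(U))^{−1}(y, y′)| ≦ B₀(L^jη)^{−4}(L^{j′}η)^{−d}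
e^{−δ₀d(y,y′)}, y, y′ ∈ 𝔅 (y ∈ Λ_j, y′ ∈ Λ_{j′}) (3.48)"* (typed as the kernel clause of `B9.Thm31and32Printed` /
`B9.Thms31to33IneqAt`), together with Lemma 2.1 of [Balaban1984PropagatorsII] = T. Bałaban, *Propagators and
renormalization transformations for lattice gauge theories. II*, Commun. Math. Phys. **96**, 223–250 (1984), p. 234
[PDF 12], verbatim: *"e^{−αδ₀d(y,y′)} ≦ e^{−αδ₀RM max{|j−j′|−1,0}}, y ∈ Λ_j, y′ ∈ Λ_{j′}, (2.60)  sup_{y∈𝔅}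
Σ_{y′∈𝔅} e^{−αδ₀d(y,y′)} ≦ c₁(α), (2.61)"* (typed over the carrier of `…B6` as `B6.Lemma21Printed`; B9 p. 397:
*"we will use the weighted distance d(y, y′) defined by (2.36) in [4]"*, and B9 p. 399 itself composes (3.25)
*"using again Lemma 2.1"* — the sibling module `…B9Ineq349`, unit pv16).  B8's hypothesis (1.40) p. 83 puts U₀
under B9's regularity condition: *"U₀ satisfies the additional regularity condition (3.35) in [4]"*, so Theorems
3.1–3.2 apply to G′(U₀), (Q′G′²Q′\*)^{−1}(U₀) (the (1.40) quotation is the one cross-read in `…B8`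
`Prop3Printed`, cell census C-pv14-3; inside B8, Prop. 6 supplies (3.35) for U₀ ∈ 𝔄_k — GAPS C-B8-16, G-IF-01 (b)).

WHAT IS REPRODUCED (0 sorry) — the derivation the two papers leave to the reader (cell GAPS row G-B8-03,
"asserted-derivable; one paragraph missing"; this module converts it into a certification).  Write H′ = G′ ·
(G′Q′\*) · (Q′G′²Q′\*)^{−1}.  For x ∈ Δ(y), y ∈ Λ_j, the quantity |(D^aH′X)(x)| (a = 0: H′X; a = 1: ∇H′X) is
dominated by the triple sum over y₁, y₂, y′ ∈ 𝔅 of [the (3.42)-entry a of the outer G′, observed at y with a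
test function localised in Δ(y₁): B₀(L^jη)^{p_a}e^{−δ₀d(y,y₁)}, p₀ = 2, p₁ = 1] × [the (3.42)-entry 0 of G′Q′\*,
observed at y₁, localised in Δ(y₂): B₀(L^{j₁}η)²e^{−δ₀d(y₁,y₂)}] × [(L^{j′}η)^d × the (3.48) kernel at (y₂, y′) ×
|X(y′)|: the coarse-measure weight (L^{j′}η)^d CANCELS the factor (L^{j′}η)^{−d} of (3.48)].  ONE application of
Lemma 2.1 of [Balaban1984PropagatorsII] then gives (1.92): the scale transfers derived from (2.60)
(`B6Cor28.transfer_of_260`, unit pv01: (L^{j₁}η)² ↦ (L^jη)² with constant L², (L^{j₂}η)^{−4} ↦ (L^jη)^{−4} with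
constant L⁴ across the chain by the triangle inequality (2.54)) turn the powers into (L^jη)^{p_a + 2 − 4} =
(L^jη)^{p_a − 2} = [1, (L^jη)^{−1}] — EXACTLY the printed prefactors (`pref2inv_eq_rpow`) — and the three remaining
exponentials, at rates ≥ δ₀ − 2ε, δ₀ − ε, δ₀ (ε the transfer rate, = αδ₀ of (2.60)), are summed one after the
other by the row-sum bound (2.61) (`chain3_le_cube`: ≤ c₁³; no (2.63)-convolution is needed because (1.92) is a
NORM bound — y′ is summed).  Result: |(D^aH′X)(x)| ≦ B′₀[1, (L^jη)^{−1}]_a |X| for x ∈ Δ(y), y ∈ Λ_j, with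
B′₀ = B₀²·B₁·L²·L⁴·c₁³ EXPLICIT (B₁, δ₁ = the (3.48) constants, printed equal to B₀, δ₀), under 0 ≤ ε, 3ε ≤ δ₀,
ε ≤ δ₁ and the largeness L⁴ ≤ e^{εRM} of the M-threshold — "depending on d and L only" as printed.  Main
theorems: `ineq192_kernel` (generic three-factor power counting over a finite multiscale set, transfers and row
sums as hypotheses), `ineq192_blocks` (over the carrier of `…B9`, from (3.42) + (3.48), transfers/row sums as
hypotheses), `ineq192_of_thms31to32` / `ineq192_of_thms31to33At` (transfers DISCHARGED from the (2.60) shape,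
row sums = the (2.61) shape), `ineq192_family` (the FAMILY statement with the printed quantifier order —
ONE B′₀ > 0 and thresholds M₁′, a₀ before the family member, the configuration and the dictionary — from the
printed Theorems 3.1–3.2 as a family statement `B9.Thm31and32Printed` (hypothesis (3.35) with Mα₀ ≤ a₀, which
is what (1.40) supplies), Lemma 2.1 in family form and fixed L across the family), `ineq192_onOmega` (the printed form "for x ∈ Ω_j": a point of Ω_j lies in a block
Δ(y), y ∈ Λ_{j″} with j″ ≥ j, and (L^{j″}η)^{−1} ≤ (L^jη)^{−1} for L ≥ 1 — B9 p. 397: *"For α negative we can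
take Ω_j instead of Ω_j∖Ω_{j+1} above"*), and `rowsum_of_349` (the kernel half of B8 p. 92 l. 17–18, verbatim
*"Let us recall that from Theorems 3.1, 3.2 of [4] it follows that |Rf| ≦ B′₀|f|"*: the (L^{j′}η)^d-weighted row
sum of entry 0 of (3.49) — `B9.Ineq349`, concluded from Theorems 3.1–3.2 in `…B9Ineq349` — is ≤ O(1)·c₁, whence
|Pf| ≤ O(1)c₁|f| and |Rf| ≤ (1 + O(1)c₁)|f| for R = I − P, (3.25)).

WHAT IS *NOT* REPRODUCED OR ASSERTED (hypotheses, each NAMED — none is a cited fact): (i) the KERNEL-COMPOSITION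
DICTIONARY `HDominated` — that sup_{x∈Δ(y)}|(D^aH′X)(x)| is dominated by the triple sum just described ((1.91)
written in kernels: the blocks Δ(y₁), y₁ ∈ 𝔅, cover Ω₀; Q′\* is a piecewise-constant extension with unitary
parallel transports, so Q′\*F splits into pieces localised in Δ(y₂) of sup norm ≤ |F(y₂)|; ((Q′G′²Q′\*)^{−1}X)(y₂)
= Σ_{y′}(L^{j′}η)^d(·)(y₂,y′)X(y′)) — and the TEST-FUNCTION DICTIONARY `B9Ineq349.ObservedBy` (λ with supp λ ⊂
Δ(y₁), |λ| ≤ 1); neither is displayed in print (cell GAPS row G-pv16-1 located the same dictionary for (3.49));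
(ii) Theorems 3.1/3.2 themselves (hypotheses `h342`, `h348`, or `B9.Thms31to33IneqAt`); (iii) Lemma 2.1 of
[Balaban1984PropagatorsII] for THIS paper's geometry — the (2.60)- and (2.61)-shaped hypotheses `h260`, `h261`
over `B9.Geometry` with the parameter R of (2.1)–(2.2) as a binder and the largeness L⁴ ≤ e^{εRM} (exactly as in
`…B9Ineq349`); (iv) the block cover of Ω_j (`hcover` of `ineq192_onOmega`) and the fine-sum dictionary behind
|Pf| ≤ (Σ_{y′}(L^{j′}η)^d sup|P|)|f|; (v) sign facts invisible to `…B9`'s structures (1 ≤ L, 0 < η, d(·,·) ≥ 0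
with the triangle inequality (2.54), B₀, B₁ ≥ 0, 𝔅 finite = a `Fintype` instance); (vi) the weighted-norm versions
(1.98) |Rf|_{(−2)} ≦ B′₀|f|_{(−2)} and (1.101) (not in G-B8-03's scope).  NOTHING of the series' end-statement
(ultraviolet stability, [Balaban1987RG1] Thm 2 ff., under adjudication by the cell `pub-balaban`) is asserted;
value = kernel-checked bookkeeping of a printed "can be obtained", NOT summit progress.  Unit `b2b-balaban-b08`
(paper sub-cell B08, gen 3); cell rows: G-B8-03 → certification C-B8-20, located dictionary G-B8-16, DIVERGENCE
D-b08.6 (the abstract typing).  Sibling modules `…B8`, `…B9`, `…B6Cor28`, `…B9Ineq349` are imported / referred to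
and NOT modified.
-/

namespace Literature.MathematicalPhysics.QuantumFieldTheory.Balaban1983to89.B8Ineq192

open B6Cor28 (TransferL)
open B9Ineq349 (ObservedBy)

/-! ## Generic three-factor power counting for a NORM bound over a finite multiscale set -/
section Generic

variable {S : Type} [Fintype S]

/-- Three successive row sums (the (2.61)/(2.62) mechanism of [Balaban1984PropagatorsII] Lemma 2.1 p. 234 with
n = 3, open end-point): if every row sum of a non-negative weight is ≤ c then
`Σ_{y₁} w(y,y₁) Σ_{y₂} w(y₁,y₂) Σ_{y′} w(y₂,y′) ≤ c³`. [cite: Balaban1984PropagatorsII, Lemma 2.1 (2.61)–(2.62) p.234] -/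
theorem chain3_le_cube (w : S → S → ℝ) (hw : ∀ u v, 0 ≤ w u v) (c : ℝ) (hrow : ∀ u, ∑ v, w u v ≤ c)
    (y : S) : ∑ y₁, w y y₁ * ∑ y₂, w y₁ y₂ * ∑ y', w y₂ y' ≤ c ^ 3 := by
  have hc : 0 ≤ c := le_trans (Finset.sum_nonneg fun v _ => hw y v) (hrow y)
  have s2 : ∀ y₁, ∑ y₂, w y₁ y₂ * ∑ y', w y₂ y' ≤ c * c := fun y₁ =>
    calc ∑ y₂, w y₁ y₂ * ∑ y', w y₂ y' ≤ ∑ y₂, w y₁ y₂ * c :=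
          Finset.sum_le_sum fun y₂ _ => mul_le_mul_of_nonneg_left (hrow y₂) (hw y₁ y₂)
      _ = (∑ y₂, w y₁ y₂) * c := by rw [Finset.sum_mul]
      _ ≤ c * c := mul_le_mul_of_nonneg_right (hrow y₁) hc
  calc ∑ y₁, w y y₁ * ∑ y₂, w y₁ y₂ * ∑ y', w y₂ y' ≤ ∑ y₁, w y y₁ * (c * c) :=
        Finset.sum_le_sum fun y₁ _ => mul_le_mul_of_nonneg_left (s2 y₁) (hw y y₁)
    _ = (∑ y₁, w y y₁) * (c * c) := by rw [Finset.sum_mul]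
    _ ≤ c * (c * c) := mul_le_mul_of_nonneg_right (hrow y) (mul_nonneg hc hc)
    _ = c ^ 3 := by ring

/-- **Three-factor multiscale power counting for a norm bound** (the pattern behind B8 (1.92) p. 91).  Over a
finite multiscale set with `ℓ > 0` and a distance `d ≥ 0` obeying the triangle inequality (2.54): if
`|K₁(y,y₁)| ≤ C₁ ℓ(y)^p e^{−a d(y,y₁)}` (outer factor D^aG′, (3.42) entry p = 2 or 1), `|K₂(y₁,y₂)| ≤ C₂ ℓ(y₁)²
e^{−b d(y₁,y₂)}` (G′Q′\*, (3.42) entry 0) and `|K₃(y₂,y′)| ≤ C₃ ℓ(y₂)^{−4} ℓ(y′)^{−d} e^{−c d(y₂,y′)}` ((3.48)), the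
scale transfers `ℓ(y₁)² ↦ ℓ(y)²` (constant A₂) and `ℓ(y₂)^{−4} ↦ ℓ(y)^{−4}` (A₄, across the chain via (2.54)) at
rate `ε ≥ 0`, and the row sums of `e^{−κ d}` are `≤ c_r` with `κ + 2ε ≤ a`, `κ + ε ≤ b`, `κ ≤ c`, then for
`|X| ≤ M` the coarse-measure-weighted triple sum obeys `Σ_{y₁,y₂,y′} |K₁||K₂|(ℓ(y′)^d|K₃||X(y′)|) ≤
C₁C₂C₃A₂A₄c_r³ · ℓ(y)^{p−2} · M` — the weight ℓ(y′)^d cancels ℓ(y′)^{−d}, and p − 2 ∈ {0, −1} are the printed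
prefactors [1, (L^jη)^{−1}] of (1.92). [cite: Balaban1985RegularSpaces, (1.92) p.91; Balaban1984PropagatorsII, Lemma 2.1 p.234] -/
theorem ineq192_kernel (ℓ : S → ℝ) (dist : S → S → ℝ) (d : ℕ) (K₁ K₂ K₃ : S → S → ℝ) (X : S → ℝ)
    (p C₁ C₂ C₃ a b c ε κ A₂ A₄ cr M : ℝ)
    (hℓ : ∀ y, 0 < ℓ y) (hdist : ∀ y y', 0 ≤ dist y y')
    (htri : ∀ x y z : S, dist x z ≤ dist x y + dist y z)
    (hC₁ : 0 ≤ C₁) (hC₂ : 0 ≤ C₂) (hC₃ : 0 ≤ C₃) (hA₂ : 0 ≤ A₂) (hA₄ : 0 ≤ A₄) (hε : 0 ≤ ε)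
    (ha : κ + 2 * ε ≤ a) (hb : κ + ε ≤ b) (hc : κ ≤ c)
    (hK₁ : ∀ y y₁, |K₁ y y₁| ≤ C₁ * ℓ y ^ p * Real.exp (-(a * dist y y₁)))
    (hK₂ : ∀ y₁ y₂, |K₂ y₁ y₂| ≤ C₂ * ℓ y₁ ^ (2 : ℝ) * Real.exp (-(b * dist y₁ y₂)))
    (hK₃ : ∀ y₂ y', |K₃ y₂ y'| ≤
      C₃ * ℓ y₂ ^ (-(4 : ℝ)) * ℓ y' ^ (-(d : ℝ)) * Real.exp (-(c * dist y₂ y')))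
    (hT₂ : TransferL ℓ dist ε (2 : ℝ) A₂) (hT₄ : TransferL ℓ dist ε (-(4 : ℝ)) A₄)
    (h261 : ∀ y, ∑ y', Real.exp (-(κ * dist y y')) ≤ cr)
    (hX : ∀ y', |X y'| ≤ M) (y : S) :
    ∑ y₁, ∑ y₂, ∑ y', |K₁ y y₁| * |K₂ y₁ y₂| * (ℓ y' ^ (d : ℝ) * |K₃ y₂ y'| * |X y'|) ≤
      C₁ * C₂ * C₃ * A₂ * A₄ * cr ^ 3 * ℓ y ^ (p - 2) * M := by
  have hy : 0 < ℓ y := hℓ y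
  have hM0 : 0 ≤ M := le_trans (abs_nonneg _) (hX y)
  set Mt : ℝ := C₁ * C₂ * C₃ * A₂ * A₄ * ℓ y ^ (p - 2) * M with hMt
  have hyp2 : 0 ≤ ℓ y ^ (p - 2) := Real.rpow_nonneg (le_of_lt hy) _
  have hMtnn : 0 ≤ Mt := by rw [hMt]; positivity
  -- the weight of the row sums
  set w : S → S → ℝ := fun u v => Real.exp (-(κ * dist u v)) with hw
  -- termwise bound
  have key : ∀ y₁ y₂ y', |K₁ y y₁| * |K₂ y₁ y₂| * (ℓ y' ^ (d : ℝ) * |K₃ y₂ y'| * |X y'|) ≤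
      Mt * (w y y₁ * (w y₁ y₂ * w y₂ y')) := by
    intro y₁ y₂ y'
    have h1p : 0 < ℓ y₁ := hℓ y₁
    have h2p : 0 < ℓ y₂ := hℓ y₂
    have h3p : 0 < ℓ y' := hℓ y'
    have E₁ := hdist y y₁
    have E₂ := hdist y₁ y₂
    have E₃ := hdist y₂ y'
    have hypow : 0 ≤ ℓ y ^ p := Real.rpow_nonneg (le_of_lt hy) _
    have hy2 : 0 ≤ ℓ y ^ (2 : ℝ) := Real.rpow_nonneg (le_of_lt hy) _
    have hym4 : 0 ≤ ℓ y ^ (-(4 : ℝ)) := Real.rpow_nonneg (le_of_lt hy) _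
    have hy24 : 0 ≤ ℓ y₂ ^ (-(4 : ℝ)) := Real.rpow_nonneg (le_of_lt h2p) _
    have hy3d : 0 ≤ ℓ y' ^ (d : ℝ) := Real.rpow_nonneg (le_of_lt h3p) _
    -- the two scale transfers to the observation point y
    have t2 : ℓ y₁ ^ (2 : ℝ) ≤ A₂ * Real.exp (ε * dist y y₁) * ℓ y ^ (2 : ℝ) := hT₂ y y₁
    have t4 : ℓ y₂ ^ (-(4 : ℝ)) ≤ A₄ * Real.exp (ε * (dist y y₁ + dist y₁ y₂)) * ℓ y ^ (-(4 : ℝ)) := by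
      have h := hT₄ y y₂
      have hd : dist y y₂ ≤ dist y y₁ + dist y₁ y₂ := htri y y₁ y₂
      have he : Real.exp (ε * dist y y₂) ≤ Real.exp (ε * (dist y y₁ + dist y₁ y₂)) :=
        Real.exp_le_exp.mpr (mul_le_mul_of_nonneg_left hd hε)
      exact h.trans (mul_le_mul_of_nonneg_right (mul_le_mul_of_nonneg_left he hA₄) hym4)
    -- the three factor bounds, scales transferred
    have b1 := hK₁ y y₁
    have b2 : |K₂ y₁ y₂| ≤ C₂ * (A₂ * Real.exp (ε * dist y y₁) * ℓ y ^ (2 : ℝ)) *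
        Real.exp (-(b * dist y₁ y₂)) := by
      refine (hK₂ y₁ y₂).trans ?_
      exact mul_le_mul_of_nonneg_right (mul_le_mul_of_nonneg_left t2 hC₂) (Real.exp_nonneg _)
    have hdd : ℓ y' ^ (d : ℝ) * ℓ y' ^ (-(d : ℝ)) = 1 := by
      rw [Real.rpow_neg (le_of_lt h3p), mul_inv_cancel₀ (ne_of_gt (Real.rpow_pos_of_pos h3p _))]
    have b3 : ℓ y' ^ (d : ℝ) * |K₃ y₂ y'| * |X y'| ≤
        C₃ * (A₄ * Real.exp (ε * (dist y y₁ + dist y₁ y₂)) * ℓ y ^ (-(4 : ℝ))) *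
          Real.exp (-(c * dist y₂ y')) * M := by
      have step1 : ℓ y' ^ (d : ℝ) * |K₃ y₂ y'| ≤
          C₃ * ℓ y₂ ^ (-(4 : ℝ)) * Real.exp (-(c * dist y₂ y')) := by
        calc ℓ y' ^ (d : ℝ) * |K₃ y₂ y'|
            ≤ ℓ y' ^ (d : ℝ) * (C₃ * ℓ y₂ ^ (-(4 : ℝ)) * ℓ y' ^ (-(d : ℝ)) *
                Real.exp (-(c * dist y₂ y'))) := mul_le_mul_of_nonneg_left (hK₃ y₂ y') hy3d
          _ = (ℓ y' ^ (d : ℝ) * ℓ y' ^ (-(d : ℝ))) *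
                (C₃ * ℓ y₂ ^ (-(4 : ℝ)) * Real.exp (-(c * dist y₂ y'))) := by ring
          _ = C₃ * ℓ y₂ ^ (-(4 : ℝ)) * Real.exp (-(c * dist y₂ y')) := by rw [hdd, one_mul]
      have step2 : C₃ * ℓ y₂ ^ (-(4 : ℝ)) * Real.exp (-(c * dist y₂ y')) ≤
          C₃ * (A₄ * Real.exp (ε * (dist y y₁ + dist y₁ y₂)) * ℓ y ^ (-(4 : ℝ))) *
            Real.exp (-(c * dist y₂ y')) :=
        mul_le_mul_of_nonneg_right (mul_le_mul_of_nonneg_left t4 hC₃) (Real.exp_nonneg _)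
      exact mul_le_mul (step1.trans step2) (hX y') (abs_nonneg _) (by positivity)
    -- multiply the three bounds
    have prod : |K₁ y y₁| * |K₂ y₁ y₂| * (ℓ y' ^ (d : ℝ) * |K₃ y₂ y'| * |X y'|) ≤
        (C₁ * ℓ y ^ p * Real.exp (-(a * dist y y₁))) *
        (C₂ * (A₂ * Real.exp (ε * dist y y₁) * ℓ y ^ (2 : ℝ)) * Real.exp (-(b * dist y₁ y₂))) *
        (C₃ * (A₄ * Real.exp (ε * (dist y y₁ + dist y₁ y₂)) * ℓ y ^ (-(4 : ℝ))) *
          Real.exp (-(c * dist y₂ y')) * M) := by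
      apply mul_le_mul (mul_le_mul b1 b2 (abs_nonneg _) (by positivity)) b3 (by positivity)
      positivity
    -- collect: the scale powers ℓ(y)^p ℓ(y)² ℓ(y)^{−4} = ℓ(y)^{p−2} and the exponentials
    have hpow : ℓ y ^ p * ℓ y ^ (2 : ℝ) * ℓ y ^ (-(4 : ℝ)) = ℓ y ^ (p - 2) := by
      rw [← Real.rpow_add hy, ← Real.rpow_add hy]
      congr 1
      ring
    have hexp : Real.exp (-(a * dist y y₁)) * Real.exp (ε * dist y y₁) * Real.exp (-(b * dist y₁ y₂)) *
        Real.exp (ε * (dist y y₁ + dist y₁ y₂)) * Real.exp (-(c * dist y₂ y')) ≤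
        w y y₁ * (w y₁ y₂ * w y₂ y') := by
      rw [hw]
      simp only [← Real.exp_add]
      apply Real.exp_le_exp.mpr
      have i1 := mul_le_mul_of_nonneg_right ha E₁
      have i2 := mul_le_mul_of_nonneg_right hb E₂
      have i3 := mul_le_mul_of_nonneg_right hc E₃
      nlinarith
    calc |K₁ y y₁| * |K₂ y₁ y₂| * (ℓ y' ^ (d : ℝ) * |K₃ y₂ y'| * |X y'|)
        ≤ _ := prod
      _ = (C₁ * C₂ * C₃ * A₂ * A₄ * (ℓ y ^ p * ℓ y ^ (2 : ℝ) * ℓ y ^ (-(4 : ℝ))) * M) *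
          (Real.exp (-(a * dist y y₁)) * Real.exp (ε * dist y y₁) * Real.exp (-(b * dist y₁ y₂)) *
            Real.exp (ε * (dist y y₁ + dist y₁ y₂)) * Real.exp (-(c * dist y₂ y'))) := by ring
      _ = Mt * (Real.exp (-(a * dist y y₁)) * Real.exp (ε * dist y y₁) * Real.exp (-(b * dist y₁ y₂)) *
            Real.exp (ε * (dist y y₁ + dist y₁ y₂)) * Real.exp (-(c * dist y₂ y'))) := by rw [hpow, hMt]
      _ ≤ Mt * (w y y₁ * (w y₁ y₂ * w y₂ y')) := mul_le_mul_of_nonneg_left hexp hMtnn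
  -- sum: three successive row sums
  have hw0 : ∀ u v, 0 ≤ w u v := fun u v => Real.exp_nonneg _
  have hrow : ∀ u, ∑ v, w u v ≤ cr := fun u => by simpa [hw] using h261 u
  have hchain := chain3_le_cube w hw0 cr hrow y
  calc ∑ y₁, ∑ y₂, ∑ y', |K₁ y y₁| * |K₂ y₁ y₂| * (ℓ y' ^ (d : ℝ) * |K₃ y₂ y'| * |X y'|)
      ≤ ∑ y₁, ∑ y₂, ∑ y', Mt * (w y y₁ * (w y₁ y₂ * w y₂ y')) :=
        Finset.sum_le_sum fun y₁ _ => Finset.sum_le_sum fun y₂ _ =>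
          Finset.sum_le_sum fun y' _ => key y₁ y₂ y'
    _ = Mt * ∑ y₁, w y y₁ * ∑ y₂, w y₁ y₂ * ∑ y', w y₂ y' := by simp only [Finset.mul_sum]
    _ ≤ Mt * cr ^ 3 := mul_le_mul_of_nonneg_left hchain hMtnn
    _ = C₁ * C₂ * C₃ * A₂ * A₄ * cr ^ 3 * ℓ y ^ (p - 2) * M := by rw [hMt]; ring

end Generic

/-! ## Over the carrier of `…B9`: (1.92) from (3.42), (3.48) and Lemma 2.1 of [4] -/
section B9Carrier

variable {g : B9.Geometry} {B : B9.Backgrounds}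

/-- The entry of (3.42) observing the OUTER factor of H′ = G′·(G′Q′\*)·(Q′G′²Q′\*)^{−1} in the a-th quantity of
(1.92): a = 0 ↦ |G′λ| (entry 0), a = 1 ↦ |∇_U G′λ| (entry 1). [cite: Balaban1985RegularSpaces, (1.91)–(1.92) p.91; Balaban1985BackgroundPropagators, (3.42) p.397] -/
def entH : Fin 2 → Fin 4 := ![0, 1]

/-- The (3.42) scale powers p₀ = 2 ((L^jη)² for G′), p₁ = 1 (L^jη for ∇G′) of the outer factor. [cite: Balaban1985BackgroundPropagators, (3.42) p.397] -/
def powH : Fin 2 → ℝ := ![2, 1]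

/-- The (3.42) prefactor of the outer entry as a real power: `pref4 t (entH a) = t^{p_a}`. [folklore] -/
theorem pref4_entH (t : ℝ) : ∀ a : Fin 2, B9.pref4 t (entH a) = t ^ powH a := by
  intro a
  fin_cases a
  · show t ^ 2 = t ^ (2 : ℝ); rw [Real.rpow_two]
  · show t = t ^ (1 : ℝ); rw [Real.rpow_one]

/-- The printed prefactors **[1, (L^jη)^{−1}]** of (1.92) p. 91. [cite: Balaban1985RegularSpaces, (1.92) p.91] -/
noncomputable def pref2inv (t : ℝ) : Fin 2 → ℝ := ![1, t⁻¹]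

/-- **The power counting of (1.92)**: [1, (L^jη)^{−1}] IS (L^jη)^{p_a + 2 − 4} = (L^jη)^{p_a − 2} — the outer
(3.42) power p_a and the (L^{j₁}η)² of G′Q′\* against the (L^{j₂}η)^{−4} of (3.48) (an identity for every
real t under Mathlib's conventions t^0 = 1, t^{−1} = t⁻¹). [cite: Balaban1985RegularSpaces, (1.92) p.91] -/
theorem pref2inv_eq_rpow (t : ℝ) : ∀ a : Fin 2, pref2inv t a = t ^ (powH a - 2) := by
  intro a
  fin_cases a
  · show (1 : ℝ) = t ^ ((2 : ℝ) - 2)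
    rw [show ((2 : ℝ) - 2) = 0 by norm_num, Real.rpow_zero]
  · show t⁻¹ = t ^ ((1 : ℝ) - 2)
    rw [show ((1 : ℝ) - 2) = -1 by norm_num, Real.rpow_neg_one]

/-- KERNEL-COMPOSITION DICTIONARY for H′ (hypothesis shape, not printed): by (1.91) H′ = G′·(G′Q′\*)·
(Q′G′²Q′\*)^{−1}, and `HX a X y` — the sup over x ∈ Δ(y) of |(H′X)(x)| (a = 0), |(∇H′X)(x)| (a = 1) for the
coarse function X (seen through its modulus profile `X : 𝔅 → ℝ`) — is dominated by the triple sum over 𝔅³ of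
the sup-kernel `K₁ a` of the outer factor D^aG′ (observation block Δ(y), source block Δ(y₁): the blocks Δ(y₁),
y₁ ∈ 𝔅, cover Ω₀), the sup-kernel `K₂` of G′Q′\* (Q′\* a piecewise-constant extension with unitary parallel
transports: Q′\*F splits into pieces localised in Δ(y₂) of sup norm ≤ |F(y₂)|), and the coarse-measure-weighted
kernel (L^{j′}η)^d |(Q′G′²Q′\*)^{−1}(y₂, y′)| |X(y′)| of p. 92's display *"(H′X)(x) = Σ_{y′∈𝔅_k}(L^{j′}η)^d
H′(x, y′)X(y′)"*.  Located, not an objection (cell GAPS G-B8-16; the same dictionary for (3.49) is G-pv16-1).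
[cite: Balaban1985RegularSpaces, (1.91) p.91 + display p.92; Balaban1985BackgroundPropagators, (3.48) p.398] -/
def HDominated [Fintype g.Site] (d : ℕ) (Cinv : B9.SiteKernel g B) (U : B.Cfg)
    (HX : Fin 2 → (g.Site → ℝ) → g.Site → ℝ) (K₁ : Fin 2 → g.Site → g.Site → ℝ)
    (K₂ : g.Site → g.Site → ℝ) : Prop :=
  ∀ (a : Fin 2) (X : g.Site → ℝ) (y : g.Site),
    HX a X y ≤ ∑ y₁, ∑ y₂, ∑ y', |K₁ a y y₁| * |K₂ y₁ y₂| * (g.len y' ^ (d : ℝ) * |Cinv.ker U y₂ y'| * |X y'|)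

/-- **(1.92) in block form** (p. 91 [PDF 17], verbatim display: *"|(H′X)(x)|, |(∇H′X)(x)| ≦ B′₀[1, (L^jη)^{−1}]|X|
for x ∈ Ω_j, (1.92)"*, p. 92: *"B′₀ is an absolute constant (depending on d and L only)"*), stated per block:
for x ∈ Δ(y), y ∈ Λ_j, and every coarse X with |X| ≤ M, `HX a X y ≤ B′₀ · [1, (L^jη)^{−1}]_a · M`.  The printed
"for x ∈ Ω_j" form is `Ineq192Omega` (weaker: `ineq192_onOmega`). [cite: Balaban1985RegularSpaces, (1.92) pp.91–92] -/
def Ineq192 (HX : Fin 2 → (g.Site → ℝ) → g.Site → ℝ) (B₀' : ℝ) : Prop :=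
  ∀ (a : Fin 2) (X : g.Site → ℝ) (M : ℝ) (y : g.Site), (∀ y', |X y'| ≤ M) →
    HX a X y ≤ B₀' * pref2inv (g.len y) a * M

/-- **(1.92) as printed, "for x ∈ Ω_j"**: `HXΩ a X j` = the sup over x ∈ Ω_j of |(D^aH′X)(x)|, bounded by
`B′₀ · [1, (L^jη)^{−1}]_a · |X|`. [cite: Balaban1985RegularSpaces, (1.92) pp.91–92] -/
def Ineq192Omega (HXΩ : Fin 2 → (g.Site → ℝ) → ℕ → ℝ) (B₀' : ℝ) : Prop :=
  ∀ (a : Fin 2) (X : g.Site → ℝ) (M : ℝ) (j : ℕ), (∀ y', |X y'| ≤ M) →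
    HXΩ a X j ≤ B₀' * pref2inv (g.L ^ j * g.eta) a * M

/-- **(1.92) at one configuration, kernel-checked** — transfers and row sums as hypotheses.  At a configuration U
at which (3.42) holds for G′ with (B₀, δ₀) and (3.48) holds with (B₁, δ₁), over a finite 𝔅 with 1 ≤ L, 0 < η,
d ≥ 0 obeying (2.54), B₀, B₁ ≥ 0: if the two quantities of (1.92) are dominated by the composition (1.91)
(`HDominated`) whose G′-factors are observed by the entries `entH a` and 0 of (3.42) (`ObservedBy`), and Lemma
2.1 of [4] is available on this carrier as the scale transfers (constants A₂, A₄ at rate ε ≥ 0) and the row-sum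
bound at a rate κ with κ + 2ε ≤ δ₀, κ ≤ δ₁, then (1.92) holds in block form with B′₀ = B₀·B₀·B₁·A₂·A₄·c_r³.
[cite: Balaban1985RegularSpaces, (1.92) p.91; Balaban1985BackgroundPropagators, Thm 3.1 (3.42) p.397 + Thm 3.2 (3.48) p.398] -/
theorem ineq192_blocks [Fintype g.Site] (d : ℕ) (Gp : B9.KernelFamily g B) (Cinv : B9.SiteKernel g B)
    (B₀ δ₀ B₁ δ₁ : ℝ) (U : B.Cfg) (h342 : B9.Ineq342_346_347 Gp B₀ δ₀ U)
    (h348 : ∀ y y' : g.Site, |Cinv.ker U y y'| ≤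
      B₁ * g.len y ^ (-(4 : ℝ)) * g.len y' ^ (-(d : ℝ)) * Real.exp (-(δ₁ * g.dist y y')))
    (hL : 1 ≤ g.L) (hη : 0 < g.eta) (hdist : ∀ y y' : g.Site, 0 ≤ g.dist y y')
    (htri : ∀ a b c : g.Site, g.dist a c ≤ g.dist a b + g.dist b c) (hB₀ : 0 ≤ B₀) (hB₁ : 0 ≤ B₁)
    (ε κ A₂ A₄ cr : ℝ) (hε : 0 ≤ ε) (hA₂ : 0 ≤ A₂) (hA₄ : 0 ≤ A₄)
    (ha : κ + 2 * ε ≤ δ₀) (hc : κ ≤ δ₁)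
    (hT₂ : TransferL g.len g.dist ε (2 : ℝ) A₂) (hT₄ : TransferL g.len g.dist ε (-(4 : ℝ)) A₄)
    (h261 : ∀ y : g.Site, ∑ y', Real.exp (-(κ * g.dist y y')) ≤ cr)
    (HX : Fin 2 → (g.Site → ℝ) → g.Site → ℝ) (K₁ : Fin 2 → g.Site → g.Site → ℝ)
    (K₂ : g.Site → g.Site → ℝ) (hH : HDominated d Cinv U HX K₁ K₂)
    (hK₁ : ∀ a : Fin 2, ObservedBy Gp U (entH a) (K₁ a)) (hK₂ : ObservedBy Gp U 0 K₂) :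
    Ineq192 HX (B₀ * B₀ * B₁ * A₂ * A₄ * cr ^ 3) := by
  intro a X M y hX
  have hlen := B9Ineq349.len_pos g hL hη
  -- the two (3.42) kernel bounds in power form
  have b1 : ∀ z y₁, |K₁ a z y₁| ≤ B₀ * g.len z ^ powH a * Real.exp (-(δ₀ * g.dist z y₁)) := by
    intro z y₁
    have hz := B9Ineq349.kernel_of_342 Gp U B₀ δ₀ hB₀ (fun w => (hlen w).le) h342 (entH a) (K₁ a)
      (hK₁ a) z y₁
    rw [pref4_entH (g.len z) a] at hz
    exact hz
  have b2 : ∀ y₁ y₂, |K₂ y₁ y₂| ≤ B₀ * g.len y₁ ^ (2 : ℝ) * Real.exp (-(δ₀ * g.dist y₁ y₂)) := by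
    intro y₁ y₂
    have hz := B9Ineq349.kernel_of_342 Gp U B₀ δ₀ hB₀ (fun w => (hlen w).le) h342 0 K₂ hK₂ y₁ y₂
    have e : B9.pref4 (g.len y₁) 0 = g.len y₁ ^ (2 : ℝ) := by
      rw [Real.rpow_two]
      simp [B9.pref4]
    rw [e] at hz
    exact hz
  have main := ineq192_kernel g.len g.dist d (K₁ a) K₂ (Cinv.ker U) X (powH a) B₀ B₀ B₁ δ₀ δ₀ δ₁ ε κ
    A₂ A₄ cr M hlen hdist htri hB₀ hB₀ hB₁ hA₂ hA₄ hε ha (by linarith) hc b1 b2 h348 hT₂ hT₄ h261 hX y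
  have hpref : g.len y ^ (powH a - 2) = pref2inv (g.len y) a := (pref2inv_eq_rpow (g.len y) a).symm
  calc HX a X y
      ≤ ∑ y₁, ∑ y₂, ∑ y', |K₁ a y y₁| * |K₂ y₁ y₂| *
          (g.len y' ^ (d : ℝ) * |Cinv.ker U y₂ y'| * |X y'|) := hH a X y
    _ ≤ B₀ * B₀ * B₁ * A₂ * A₄ * cr ^ 3 * g.len y ^ (powH a - 2) * M := main
    _ = B₀ * B₀ * B₁ * A₂ * A₄ * cr ^ 3 * pref2inv (g.len y) a * M := by rw [hpref]

/-- **(1.92) at one configuration from Theorems 3.1–3.2 of [4] and Lemma 2.1, everything but the dictionary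
discharged.**  Lemma 2.1 of [Balaban1984PropagatorsII] enters on B9's carrier as the (2.60) shape `h260` and the
(2.61) row-sum shape `h261` at one rate ε ≥ 0 (printed: ε = αδ₀, 0 < α < 1, c = c₁(α); R the parameter of
(2.1)–(2.2)), with the largeness L⁴ ≤ e^{εRM} of the M-threshold; the transfers are then
`B6Cor28.transfer_of_260` (constants L², L⁴).  Rates: 3ε ≤ δ₀, ε ≤ δ₁ (with δ₁ = δ₀ as printed, ε = δ₀/3
works).  Conclusion: (1.92) in block form with **B′₀ = B₀²·B₁·L²·L⁴·c³** — "depending on d and L only".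
[cite: Balaban1985RegularSpaces, (1.92) pp.91–92; Balaban1985BackgroundPropagators, Thms 3.1–3.2 pp.397–398; Balaban1984PropagatorsII, Lemma 2.1 p.234] -/
theorem ineq192_of_thms31to32 [Fintype g.Site] (d : ℕ) (Gp : B9.KernelFamily g B) (Cinv : B9.SiteKernel g B)
    (B₀ δ₀ B₁ δ₁ : ℝ) (U : B.Cfg) (h342 : B9.Ineq342_346_347 Gp B₀ δ₀ U)
    (h348 : ∀ y y' : g.Site, |Cinv.ker U y y'| ≤
      B₁ * g.len y ^ (-(4 : ℝ)) * g.len y' ^ (-(d : ℝ)) * Real.exp (-(δ₁ * g.dist y y')))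
    (hL : 1 ≤ g.L) (hη : 0 < g.eta) (hdist : ∀ y y' : g.Site, 0 ≤ g.dist y y')
    (htri : ∀ a b c : g.Site, g.dist a c ≤ g.dist a b + g.dist b c) (hB₀ : 0 ≤ B₀) (hB₁ : 0 ≤ B₁)
    (R ε c : ℝ) (hε : 0 ≤ ε) (h3 : 3 * ε ≤ δ₀) (h1 : ε ≤ δ₁)
    (h260 : ∀ y y' : g.Site, Real.exp (-(ε * g.dist y y')) ≤
      Real.exp (-(ε * R * g.M * max (|(g.scale y : ℝ) - (g.scale y' : ℝ)| - 1) 0)))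
    (h261 : ∀ y : g.Site, ∑ y' : g.Site, Real.exp (-(ε * g.dist y y')) ≤ c)
    (hl4 : g.L ^ (4 : ℝ) ≤ Real.exp (ε * R * g.M))
    (HX : Fin 2 → (g.Site → ℝ) → g.Site → ℝ) (K₁ : Fin 2 → g.Site → g.Site → ℝ)
    (K₂ : g.Site → g.Site → ℝ) (hH : HDominated d Cinv U HX K₁ K₂)
    (hK₁ : ∀ a : Fin 2, ObservedBy Gp U (entH a) (K₁ a)) (hK₂ : ObservedBy Gp U 0 K₂) :
    Ineq192 HX (B₀ * B₀ * B₁ * g.L ^ (2 : ℝ) * g.L ^ (4 : ℝ) * c ^ 3) := by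
  have hL0 : 0 ≤ g.L := le_trans zero_le_one hL
  have e4 : |(-(4 : ℝ))| = 4 := by norm_num
  have e2 : |(2 : ℝ)| = 2 := by norm_num
  have hl2 : g.L ^ (2 : ℝ) ≤ Real.exp (ε * R * g.M) :=
    (Real.rpow_le_rpow_of_exponent_le hL (by norm_num : (2 : ℝ) ≤ 4)).trans hl4
  have hT₄ := (B6Cor28.transfer_of_260 g.scale g.dist g.L g.eta ε R g.M (-(4 : ℝ)) hL hη
    (by rw [e4]; exact hl4) h260).2
  have hT₂ := (B6Cor28.transfer_of_260 g.scale g.dist g.L g.eta ε R g.M (2 : ℝ) hL hη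
    (by rw [e2]; exact hl2) h260).2
  rw [e4] at hT₄
  rw [e2] at hT₂
  rw [← B9Ineq349.len_eq_rpow] at hT₄ hT₂
  exact ineq192_blocks d Gp Cinv B₀ δ₀ B₁ δ₁ U h342 h348 hL hη hdist htri hB₀ hB₁ ε ε (g.L ^ (2 : ℝ))
    (g.L ^ (4 : ℝ)) c hε (Real.rpow_nonneg hL0 _) (Real.rpow_nonneg hL0 _) (by linarith) h1 hT₂ hT₄ h261
    HX K₁ K₂ hH hK₁ hK₂

/-- The same, from the bundled predicate "the inequalities of Theorems 3.1–3.3 hold at U" of `…B9`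
(`B9.Thms31to33IneqAt`; only its (3.42) clause for G′ and its (3.48) clause are used). [cite: Balaban1985RegularSpaces, (1.92) pp.91–92; Balaban1985BackgroundPropagators, Thms 3.1–3.3 pp.397–399] -/
theorem ineq192_of_thms31to33At [Fintype g.Site] (d : ℕ) (Gp GA : B9.KernelFamily g B)
    (Cinv : B9.SiteKernel g B) (B₀ δ₀ : ℝ) (Bβ Bε : ℝ → ℝ) (Bεβ : ℝ → ℝ → ℝ) (B₁ δ₁ : ℝ) (U : B.Cfg)
    (h : B9.Thms31to33IneqAt d Gp GA Cinv B₀ δ₀ Bβ Bε Bεβ B₁ δ₁ U)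
    (hL : 1 ≤ g.L) (hη : 0 < g.eta) (hdist : ∀ y y' : g.Site, 0 ≤ g.dist y y')
    (htri : ∀ a b c : g.Site, g.dist a c ≤ g.dist a b + g.dist b c) (hB₀ : 0 ≤ B₀) (hB₁ : 0 ≤ B₁)
    (R ε c : ℝ) (hε : 0 ≤ ε) (h3 : 3 * ε ≤ δ₀) (h1 : ε ≤ δ₁)
    (h260 : ∀ y y' : g.Site, Real.exp (-(ε * g.dist y y')) ≤
      Real.exp (-(ε * R * g.M * max (|(g.scale y : ℝ) - (g.scale y' : ℝ)| - 1) 0)))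
    (h261 : ∀ y : g.Site, ∑ y' : g.Site, Real.exp (-(ε * g.dist y y')) ≤ c)
    (hl4 : g.L ^ (4 : ℝ) ≤ Real.exp (ε * R * g.M))
    (HX : Fin 2 → (g.Site → ℝ) → g.Site → ℝ) (K₁ : Fin 2 → g.Site → g.Site → ℝ)
    (K₂ : g.Site → g.Site → ℝ) (hH : HDominated d Cinv U HX K₁ K₂)
    (hK₁ : ∀ a : Fin 2, ObservedBy Gp U (entH a) (K₁ a)) (hK₂ : ObservedBy Gp U 0 K₂) :
    Ineq192 HX (B₀ * B₀ * B₁ * g.L ^ (2 : ℝ) * g.L ^ (4 : ℝ) * c ^ 3) :=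
  ineq192_of_thms31to32 d Gp Cinv B₀ δ₀ B₁ δ₁ U h.1.1 h.2.1 hL hη hdist htri hB₀ hB₁ R ε c hε h3 h1 h260
    h261 hl4 HX K₁ K₂ hH hK₁ hK₂

/-- **From blocks to "x ∈ Ω_j"** (the printed form of (1.92)).  A point x ∈ Ω_j lies in a block Δ(y) = B^{j″}(y),
y ∈ Λ_{j″} with j″ ≥ j (the blocks Δ(y), y ∈ 𝔅, cover Ω₀ and Λ_{j″} ⊂ Ω_{j″}; hypothesis `hcover`: the sup over
Ω_j is attained in such a block), and for L ≥ 1, η > 0 one has (L^{j″}η)^{−1} ≤ (L^jη)^{−1} — B9 p. 397 on the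
weighted norms (3.41): *"For α negative we can take Ω_j instead of Ω_j∖Ω_{j+1} above."*  Hence the block form
implies the printed form with the same B′₀ ≥ 0. [cite: Balaban1985RegularSpaces, (1.92) p.91; Balaban1985BackgroundPropagators, (3.41) p.397] -/
theorem ineq192_onOmega (HX : Fin 2 → (g.Site → ℝ) → g.Site → ℝ) (HXΩ : Fin 2 → (g.Site → ℝ) → ℕ → ℝ)
    (B₀' : ℝ) (hB : 0 ≤ B₀') (hL : 1 ≤ g.L) (hη : 0 < g.eta)
    (hcover : ∀ (a : Fin 2) (X : g.Site → ℝ) (j : ℕ), ∃ y : g.Site, j ≤ g.scale y ∧ HXΩ a X j ≤ HX a X y)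
    (h : Ineq192 HX B₀') : Ineq192Omega HXΩ B₀' := by
  intro a X M j hX
  obtain ⟨y, hj, hle⟩ := hcover a X j
  have hM : 0 ≤ M := le_trans (abs_nonneg _) (hX y)
  have hy := h a X M y hX
  have hL0 : 0 < g.L := lt_of_lt_of_le one_pos hL
  have hjj : g.L ^ j * g.eta ≤ g.len y := by
    unfold B9.Geometry.len
    exact mul_le_mul_of_nonneg_right (pow_le_pow_right₀ hL hj) hη.le
  have hpos : 0 < g.L ^ j * g.eta := mul_pos (pow_pos hL0 _) hη
  have hmono : pref2inv (g.len y) a ≤ pref2inv (g.L ^ j * g.eta) a := by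
    fin_cases a
    · show (1 : ℝ) ≤ 1
      exact le_rfl
    · show (g.len y)⁻¹ ≤ (g.L ^ j * g.eta)⁻¹
      exact inv_anti₀ hpos hjj
  calc HXΩ a X j ≤ HX a X y := hle
    _ ≤ B₀' * pref2inv (g.len y) a * M := hy
    _ ≤ B₀' * pref2inv (g.L ^ j * g.eta) a * M :=
        mul_le_mul_of_nonneg_right (mul_le_mul_of_nonneg_left hmono hB) hM

/-! ### p. 92 l. 17–18: "from Theorems 3.1, 3.2 of [4] it follows that |Rf| ≦ B′₀|f|" — the kernel half -/

/-- **Row sum of (3.49), entry 0** (B8 p. 92, verbatim: *"Let us recall that from Theorems 3.1, 3.2 of [4] it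
follows that |Rf| ≦ B′₀|f|"*; R = I − P by [4] (3.25) p. 394, and P obeys (3.49) p. 399 — `B9.Ineq349`, concluded
from Theorems 3.1–3.2 and Lemma 2.1 in `…B9Ineq349`): if (3.49) holds at U with (C, δ₀), C ≥ 0, and the row sums
of e^{−κd} are ≤ c for a rate κ ≤ ½δ₀ (the (2.61) shape), then the coarse-measure-weighted row sum of the sup
kernel of P is bounded: `Σ_{y′} (L^{j′}η)^d · sup_{Δ(y)×Δ(y′)}|P| ≤ C·c` — whence (fine-sum dictionary, the
reader's) |(Pf)(x)| ≤ C c |f| and |Rf| ≤ (1 + C c)|f|.  The weighted version (1.98) is NOT typed here.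
[cite: Balaban1985RegularSpaces, p.92; Balaban1985BackgroundPropagators, (3.49) p.399 + (3.25) p.394] -/
theorem rowsum_of_349 [Fintype g.Site] (d : ℕ) (P : B9.FineKernel g B) (C δ₀ : ℝ) (U : B.Cfg)
    (h349 : B9.Ineq349 d P C δ₀ U) (hC : 0 ≤ C) (hL : 1 ≤ g.L) (hη : 0 < g.eta)
    (hdist : ∀ y y' : g.Site, 0 ≤ g.dist y y') (κ c : ℝ) (hκ : κ ≤ δ₀ / 2)
    (h261 : ∀ y : g.Site, ∑ y', Real.exp (-(κ * g.dist y y')) ≤ c) (y : g.Site) :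
    ∑ y', g.len y' ^ (d : ℝ) * P.ker 0 U y y' ≤ C * c := by
  have hlen := B9Ineq349.len_pos g hL hη
  have term : ∀ y', g.len y' ^ (d : ℝ) * P.ker 0 U y y' ≤ C * Real.exp (-(κ * g.dist y y')) := by
    intro y'
    have h := h349 0 y y'
    have e1 : B9.pref4inv (g.len y) 0 = 1 := by simp [B9.pref4inv]
    rw [e1, mul_one] at h
    have hd : 0 < g.len y' ^ (d : ℝ) := Real.rpow_pos_of_pos (hlen y') _
    have hdd : g.len y' ^ (d : ℝ) * g.len y' ^ (-(d : ℝ)) = 1 := by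
      rw [Real.rpow_neg (hlen y').le, mul_inv_cancel₀ (ne_of_gt hd)]
    have hrate : Real.exp (-(δ₀ / 2 * g.dist y y')) ≤ Real.exp (-(κ * g.dist y y')) :=
      Real.exp_le_exp.mpr (neg_le_neg (mul_le_mul_of_nonneg_right hκ (hdist y y')))
    calc g.len y' ^ (d : ℝ) * P.ker 0 U y y'
        ≤ g.len y' ^ (d : ℝ) * (C * g.len y' ^ (-(d : ℝ)) * Real.exp (-(δ₀ / 2 * g.dist y y'))) :=
          mul_le_mul_of_nonneg_left h hd.le
      _ = C * (g.len y' ^ (d : ℝ) * g.len y' ^ (-(d : ℝ))) * Real.exp (-(δ₀ / 2 * g.dist y y')) := by ring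
      _ = C * Real.exp (-(δ₀ / 2 * g.dist y y')) := by rw [hdd, mul_one]
      _ ≤ C * Real.exp (-(κ * g.dist y y')) := mul_le_mul_of_nonneg_left hrate hC
  calc ∑ y', g.len y' ^ (d : ℝ) * P.ker 0 U y y' ≤ ∑ y', C * Real.exp (-(κ * g.dist y y')) :=
        Finset.sum_le_sum fun y' _ => term y'
    _ = C * ∑ y', Real.exp (-(κ * g.dist y y')) := by rw [Finset.mul_sum]
    _ ≤ C * c := mul_le_mul_of_nonneg_left (h261 y) hC

/-- The arithmetic of the p. 92 sentence: R = I − P, |Pf| ≤ C c |f| ⇒ |Rf| ≤ (1 + C c)|f| (so B8's B′₀ may be taken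
≥ max of the (1.92) constant and 1 + C c). [folklore] -/
theorem rf_bound {Rf Pf f Cc : ℝ} (hR : Rf ≤ f + Pf) (hP : Pf ≤ Cc * f) : Rf ≤ (1 + Cc) * f := by
  linarith

/-! ### The family statement: "B′₀ is an absolute constant (depending on d and L only)" -/

/-- **(1.92) as a family statement, from the printed Theorems 3.1–3.2 of [4] as a family statement.**
`B9.Thm31and32Printed` binds M₁, δ₀, a₀, B₀ BEFORE the family member i (= torus, k, {Ω_j}, M, for fixed d, L)
and the configuration U, under the hypothesis (3.35) with Mα₀ ≤ a₀ — exactly what B8's (1.40) p. 83 supplies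
(*"U₀ satisfies the additional regularity condition (3.35) in [4]"*).  Granting Lemma 2.1 of
[Balaban1984PropagatorsII] in family form — (2.59)/(2.60): d(y, y′) ≥ RM·max{|j − j′| − 1, 0} with one R > 0
(the R of (2.1)–(2.2)); (2.61): for every rate ε > 0 ONE row-sum constant c₁ serving the whole family — and L
fixed (≥ 1) across the family, ONE constant B′₀ > 0 (namely B₀³·L²·L⁴·max{c₁(δ₀/3), 1}³) and thresholds
M₁′ = max{M₁, L⁴/((δ₀/3)R)} (making L⁴ ≤ e^{(δ₀/3)RM}), a₀ serve every family member with M ≥ M₁′, every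
α₀ > 0 with Mα₀ ≤ a₀, every U satisfying (3.35), and every kernel dictionary (`HDominated`, `ObservedBy`):
(1.92) holds in block form with that B′₀ — "depending on d and L only" in the printed sense (through B₀, δ₀,
c₁, R, L).  The dictionary and Lemma 2.1 remain hypotheses; nothing else is used.
[cite: Balaban1985RegularSpaces, (1.92) pp.91–92 + (1.40) p.83; Balaban1985BackgroundPropagators, Thms 3.1–3.2 pp.397–398; Balaban1984PropagatorsII, Lemma 2.1 (2.59)–(2.61) p.234] -/
theorem ineq192_family {I : Type} (d : ℕ) (c35 L : ℝ) (geo : I → B9.Geometry) (bg : I → B9.Backgrounds)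
    [hF : ∀ i, Fintype (geo i).Site]
    (Gp : ∀ i, B9.KernelFamily (geo i) (bg i)) (Cinv : ∀ i, B9.SiteKernel (geo i) (bg i))
    (h : B9.Thm31and32Printed d c35 geo bg Gp Cinv)
    (hLfix : ∀ i, (geo i).L = L) (hL : 1 ≤ L) (hη : ∀ i, 0 < (geo i).eta)
    (hdist : ∀ (i : I) (y y' : (geo i).Site), 0 ≤ (geo i).dist y y')
    (htri : ∀ (i : I) (a b c : (geo i).Site), (geo i).dist a c ≤ (geo i).dist a b + (geo i).dist b c)
    (h259 : ∃ R : ℝ, 0 < R ∧ ∀ (i : I) (y y' : (geo i).Site),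
      R * (geo i).M * max (|((geo i).scale y : ℝ) - ((geo i).scale y' : ℝ)| - 1) 0 ≤ (geo i).dist y y')
    (h261 : ∀ ε : ℝ, 0 < ε → ∃ c : ℝ, ∀ (i : I) (y : (geo i).Site),
      ∑ y', Real.exp (-(ε * (geo i).dist y y')) ≤ c) :
    ∃ M₁' a₀ B₀' : ℝ, 0 < M₁' ∧ 0 < a₀ ∧ 0 < B₀' ∧
      ∀ i : I, M₁' ≤ (geo i).M → ∀ α₀ : ℝ, 0 < α₀ → (geo i).M * α₀ ≤ a₀ →
        ∀ U : (bg i).Cfg, (bg i).Reg335 c35 α₀ U →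
          ∀ (HX : Fin 2 → ((geo i).Site → ℝ) → (geo i).Site → ℝ)
            (K₁ : Fin 2 → (geo i).Site → (geo i).Site → ℝ) (K₂ : (geo i).Site → (geo i).Site → ℝ),
            HDominated d (Cinv i) U HX K₁ K₂ → (∀ a : Fin 2, ObservedBy (Gp i) U (entH a) (K₁ a)) →
              ObservedBy (Gp i) U 0 K₂ → Ineq192 HX B₀' := by
  obtain ⟨M₁, δ₀, a₀, B₀, Bβ, Bε, Bεβ, hM₁, hδ₀, ha₀, hB₀, hall⟩ := h
  obtain ⟨R, hR, hRd⟩ := h259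
  -- the transfer rate ε = δ₀/3 (3ε ≤ δ₀, ε ≤ δ₁ = δ₀) and its (2.61) row-sum constant
  set ε : ℝ := δ₀ / 3 with hεdef
  have hε0 : 0 < ε := by rw [hεdef]; positivity
  obtain ⟨c, hc⟩ := h261 ε hε0
  set c' : ℝ := max c 1 with hc'def
  have hc'0 : 0 < c' := lt_of_lt_of_le one_pos (le_max_right _ _)
  have hL0 : 0 < L := lt_of_lt_of_le one_pos hL
  -- the M-threshold making L⁴ ≤ e^{εRM}
  set M₂ : ℝ := L ^ 4 / (ε * R) with hM₂def
  refine ⟨max M₁ M₂, a₀, B₀ * B₀ * B₀ * L ^ (2 : ℝ) * L ^ (4 : ℝ) * c' ^ 3,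
    lt_max_iff.mpr (Or.inl hM₁), ha₀, by positivity, ?_⟩
  intro i hMi α₀ hα₀ hMa U hU HX K₁ K₂ hH hK₁ hK₂
  have hM₁i : M₁ ≤ (geo i).M := (le_max_left _ _).trans hMi
  obtain ⟨h342, -, h348⟩ := hall i hM₁i α₀ hα₀ hMa U hU
  have hLi : 1 ≤ (geo i).L := by rw [hLfix i]; exact hL
  -- (2.60) at rate ε from (2.59)
  have h260 : ∀ y y' : (geo i).Site, Real.exp (-(ε * (geo i).dist y y')) ≤
      Real.exp (-(ε * R * (geo i).M * max (|((geo i).scale y : ℝ) - ((geo i).scale y' : ℝ)| - 1) 0)) := by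
    intro y y'
    apply Real.exp_le_exp.mpr
    apply neg_le_neg
    have := mul_le_mul_of_nonneg_left (hRd i y y') hε0.le
    calc ε * R * (geo i).M * max (|((geo i).scale y : ℝ) - ((geo i).scale y' : ℝ)| - 1) 0
        = ε * (R * (geo i).M * max (|((geo i).scale y : ℝ) - ((geo i).scale y' : ℝ)| - 1) 0) := by ring
      _ ≤ ε * (geo i).dist y y' := this
  have h261i : ∀ y : (geo i).Site, ∑ y', Real.exp (-(ε * (geo i).dist y y')) ≤ c' :=
    fun y => (hc i y).trans (le_max_left _ _)
  -- largeness L⁴ ≤ e^{εRM} for M ≥ M₂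
  have hl4 : (geo i).L ^ (4 : ℝ) ≤ Real.exp (ε * R * (geo i).M) := by
    rw [hLfix i, show (4 : ℝ) = ((4 : ℕ) : ℝ) by norm_num, Real.rpow_natCast]
    have hM2 : M₂ ≤ (geo i).M := (le_max_right _ _).trans hMi
    rw [hM₂def, div_le_iff₀ (mul_pos hε0 hR)] at hM2
    have h1 := Real.add_one_le_exp (ε * R * (geo i).M)
    nlinarith [hM2, h1]
  have key := ineq192_of_thms31to32 d (Gp i) (Cinv i) B₀ δ₀ B₀ δ₀ U h342 h348 hLi (hη i) (hdist i) (htri i)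
    hB₀.le hB₀.le R ε c' hε0.le (by rw [hεdef]; linarith) (by rw [hεdef]; linarith) h260 h261i hl4 HX K₁ K₂
    hH hK₁ hK₂
  rw [hLfix i] at key
  exact key

end B9Carrier

end Literature.MathematicalPhysics.QuantumFieldTheory.Balaban1983to89.B8Ineq192
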